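import Summits.BirchSwinnertonDyer.Rank1Residual.X11b.AnticyclotomicEmbedding
import Literature.NumberTheory.Automorphic.HilbertPartialHasseWeightShiftingProofs
import Mathlib.NumberTheory.Padics.Complex
import HarnessLib

/-!
# X11b, route R1 — the prime `𝔭_ι` of `K` induced by an embedding datum `ι : ℚ̄_p ≃ ℂ`
# (Castella–Hsieh's "prime induced by `i_p = ι⁻¹ ∘ i_∞`"), with the compatibility clause of
# Castella 2018 Thm. 3.1 (tree fact `castella2018_exists_isBDPLFunction`) BY CONSTRUCTION

HONEST FRAMING (cell `b2b-bsdres`, run/shared/lean/b2b/bsd-rank1-residual/, verbatim in every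
file): the goal of the cell is to DELETE the COMBINATION-SHAPED residual classes of the
Birch–Swinnerton-Dyer formula for ALL analytic-rank `≤ 1` elliptic curves over `ℚ` — "full BSD
formula for every rank `≤ 1` curve in class `C`" assembled STRICTLY from published theorems — so
that the rank-`≤ 1` remainder becomes exactly the CONSTRUCTION-SHAPED classes, which are TYPED
(missing-input `Prop`s), NOT attempted. This is not "finishing BSD". Sub-cell
`b2b-bsdres-multr1-p1` (X11b, route R1); a RESEARCH ROUTE; no claim beyond the stated class; X11b
stays CONSTRUCTION-SHAPED; nothing here changes a label; no named fact (two definitions with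
bodies — a ring map and a prime — and theorems; no `sorry`).

## Why (gen 20)

The registered PUBLISHED fact `Literature.NumberTheory.EllipticCurves.castella2018_exists_isBDPLFunction`
(Castella, Camb. J. Math. 6 (2018) Thm. 3.1: the BDP anticyclotomic `p`-adic `L`-function
`L_p(f) ∈ Λ_{R₀}` with its interpolation property, `p ≥ 5`, semistable `E`) has, so far, NO
consumer under `Summits/`. Its one non-arithmetic hypothesis is the COMPATIBILITY of the
distinguished prime `𝔭 ∣ p` of `K` with the embedding datum `ι : ℚ̄_p ≃ ℂ` through which infinity
types and Frobenius polynomials are read: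
`∀ (w : InfinitePlace K) (k : 𝓞 K), k ∈ 𝔭 ↔ ‖ι⁻¹(w.embedding k)‖ < 1`
("`𝔭` the prime induced by `i_p = ι⁻¹ ∘ i_∞`", Castella–Hsieh 2018 §3.3). This file CONSTRUCTS that
prime from `ι` — for every number field `K` and every `σ : K →+* ℂ` — so that the fact can be
instantiated at route R1's data (`RouteR1BDPExists.lean`) without choosing `ι` prime by prime:

* `padicEmbOfDatum p ι σ : K →+* ℚ̄_p` — `i_p := ι⁻¹ ∘ σ`;
* `primeOfEmbeddingDatum p ι σ : HeightOneSpectrum (𝓞 K)` — the prime `{k ∈ 𝓞 K : ‖i_p(k)‖ < 1}`: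
  an ideal because the norm of `ℚ̄_p` (Mathlib `PadicAlgCl p`, the spectral norm) is
  non-archimedean and algebraic integers have norm `≤ 1` (tree
  `Literature.NumberTheory.Automorphic.PadicAlgCl.norm_le_one_of_isIntegral`); prime because the
  norm is multiplicative; non-zero because it contains `p` (`‖p‖ = p⁻¹ < 1`);
* `mem_primeOfEmbeddingDatum_iff` (the compatibility clause, by `Iff.rfl`),
  `natCast_mem_primeOfEmbeddingDatum` (`p ∈ 𝔭_ι`), `eq_primeOfEmbeddingDatum_of_forall_mem_iff`
  (ANY prime satisfying the clause is `𝔭_ι` — the clause determines `𝔭`);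
* `subsingleton_infinitePlace_of_isImaginaryQuadratic` (an imaginary quadratic field has ONE
  infinite place: `r₁ = 0`, `r₁ + 2r₂ = 2`) and hence `forall_mem_primeOfEmbeddingDatum_iff` — the
  clause in the EXACT `∀ w` form of the fact;
* `degreeOne_primeOfEmbeddingDatum` — `e(𝔭_ι|p) = f(𝔭_ι|p) = 1` when `p` splits in the quadratic
  `K` (tree `degreeOne_of_splitsIn`), so `𝔭_ι` is one of the two degree-one primes over which route
  R1's open input `R1OpenInputOnTreeAt` quantifies (`embAt K p 𝔭_ι`).

* (gen 20 append) `primeOfEmbeddingDatum_trans_starRingAut` (`𝔭_{ι ∘ conj, σ} = 𝔭_{ι, σ̄}`) and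
  `eq_primeOfEmbeddingDatum_or_eq_trans_starRingAut` / `exists_datum_forall_mem_iff`: for an
  imaginary quadratic `K`, EVERY prime `𝔭 ∋ p` is `𝔭_ι` or `𝔭_{ι ∘ conj}` (Galois transitivity on
  the primes above `p` + uniqueness of the infinite place) — so the two data `ι`, `ι ∘ conj` cover
  all primes above `p`, and no datum has to be chosen prime by prime.

Nothing here is specific to `p ≥ 5` or to X11b; nothing is asserted about any `L`-function.

References: [CastellaHsieh2018] §3.3 (conventions: `i_p`, `i_∞`, "the prime induced by `i_p`");
[Castella2018] Thm. 3.1 (the fact's compatibility clause); [Neukirch1999] II (8.1)–(8.2)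
(extensions of valuations along embeddings into `ℚ̄_p`); [CasselsFrohlichANT1967] Ch. VII
Prop. 1.2 (ii) (transitivity of `Gal` on the primes above `p`).
-/

noncomputable section

open scoped Classical

open NumberField IsDedekindDomain Literature.NumberTheory.EllipticCurves
  Literature.NumberTheory.EllipticCurves.Rank1Residual

namespace Summit.BirchSwinnertonDyer.Rank1Residual.X11b

/-! ### The prime of `K` induced by an embedding datum -/

section Prime

variable {K : Type} [Field K] (p : ℕ) [Fact p.Prime] (ι : PadicAlgCl p ≃+* ℂ) (σ : K →+* ℂ)

/-- **`i_p := ι⁻¹ ∘ σ : K →+* ℚ̄_p`** — the `p`-adic embedding of `K` determined by the complex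
embedding `σ` (meant: `i_∞|_K`, in the tree `w.embedding` for the infinite place `w`) and the
embedding datum `ι : ℚ̄_p ≃ ℂ` (Castella–Hsieh 2018 §3.3: "`i_p = ι⁻¹ ∘ i_∞`").
[cite: CastellaHsieh2018, §3.3 (arXiv:1505.08165 p. 9)] -/
def padicEmbOfDatum : K →+* PadicAlgCl p :=
  ι.symm.toRingHom.comp σ

/-- `i_p(k) = ι⁻¹(σ k)`. [cite: CastellaHsieh2018, §3.3 (arXiv:1505.08165 p. 9)] -/
@[simp]
theorem padicEmbOfDatum_apply (k : K) : padicEmbOfDatum p ι σ k = ι.symm (σ k) := rfl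

/-- Integers of `K` land in the closed unit ball of `ℚ̄_p` under `i_p`. [folklore] -/
theorem norm_padicEmbOfDatum_le_one (k : 𝓞 K) : ‖padicEmbOfDatum p ι σ (k : K)‖ ≤ 1 :=
  Literature.NumberTheory.Automorphic.PadicAlgCl.norm_le_one_of_isIntegral p
    ((RingOfIntegers.isIntegral_coe k).map (padicEmbOfDatum p ι σ).toIntAlgHom)

/-- The ideal `{k ∈ 𝓞 K : ‖i_p(k)‖ < 1}` of `𝓞 K` (an ideal: the norm of `ℚ̄_p` is non-archimedean and
`‖i_p(c)‖ ≤ 1` for `c ∈ 𝓞 K`). [folklore] -/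
def primeOfEmbeddingDatumIdeal : Ideal (𝓞 K) where
  carrier := {k | ‖padicEmbOfDatum p ι σ (k : K)‖ < 1}
  zero_mem' := by simp
  add_mem' {a b} ha hb := by
    simp only [Set.mem_setOf_eq, RingOfIntegers.coe_eq_algebraMap, map_add] at ha hb ⊢
    exact (PadicAlgCl.isNonarchimedean p _ _).trans_lt (max_lt ha hb)
  smul_mem' c {x} hx := by
    simp only [Set.mem_setOf_eq, smul_eq_mul, RingOfIntegers.coe_eq_algebraMap, map_mul,
      norm_mul] at hx ⊢
    calc ‖padicEmbOfDatum p ι σ (algebraMap (𝓞 K) K c)‖ *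
          ‖padicEmbOfDatum p ι σ (algebraMap (𝓞 K) K x)‖
        ≤ 1 * ‖padicEmbOfDatum p ι σ (algebraMap (𝓞 K) K x)‖ :=
          mul_le_mul_of_nonneg_right (norm_padicEmbOfDatum_le_one p ι σ c) (norm_nonneg _)
      _ < 1 := by rwa [one_mul]

/-- Membership in the induced ideal is the norm condition. [folklore] -/
theorem mem_primeOfEmbeddingDatumIdeal_iff (k : 𝓞 K) :
    k ∈ primeOfEmbeddingDatumIdeal p ι σ ↔ ‖ι.symm (σ (k : K))‖ < 1 := Iff.rfl

/-- `p` lies in the induced ideal (`‖i_p(p)‖ = ‖p‖_p = p⁻¹ < 1`). [folklore] -/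
theorem natCast_mem_primeOfEmbeddingDatumIdeal :
    ((p : ℕ) : 𝓞 K) ∈ primeOfEmbeddingDatumIdeal p ι σ := by
  rw [mem_primeOfEmbeddingDatumIdeal_iff]
  have h : σ (((p : ℕ) : 𝓞 K) : K) = (p : ℂ) := by simp
  rw [h, map_natCast]
  exact Literature.NumberTheory.Automorphic.PadicAlgCl.norm_natCast_p_lt_one p

/-- The induced ideal is prime (`‖·‖` is multiplicative and `‖1‖ = 1`). [folklore] -/
theorem isPrime_primeOfEmbeddingDatumIdeal : (primeOfEmbeddingDatumIdeal p ι σ).IsPrime := by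
  refine ⟨?_, fun {a b} hab ↦ ?_⟩
  · rw [Ideal.ne_top_iff_one, mem_primeOfEmbeddingDatumIdeal_iff]
    simp
  · rw [mem_primeOfEmbeddingDatumIdeal_iff] at hab ⊢
    rw [mem_primeOfEmbeddingDatumIdeal_iff]
    by_contra h
    push Not at h
    obtain ⟨ha, hb⟩ := h
    have hab' : ‖ι.symm (σ ((a * b : 𝓞 K) : K))‖ = ‖ι.symm (σ (a : K))‖ * ‖ι.symm (σ (b : K))‖ := by
      simp [map_mul, norm_mul]
    have : (1 : ℝ) ≤ ‖ι.symm (σ (a : K))‖ * ‖ι.symm (σ (b : K))‖ := by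
      simpa using mul_le_mul ha hb zero_le_one (le_trans zero_le_one ha)
    linarith

variable [NumberField K]

/-- The induced ideal is non-zero (it contains `p ≠ 0`; `𝓞 K` has characteristic zero). [folklore] -/
theorem primeOfEmbeddingDatumIdeal_ne_bot : primeOfEmbeddingDatumIdeal p ι σ ≠ ⊥ := by
  intro h
  have hp := natCast_mem_primeOfEmbeddingDatumIdeal p ι σ
  rw [h, Ideal.mem_bot] at hp
  exact (Nat.cast_ne_zero.mpr (Fact.out : p.Prime).ne_zero) hp

/-- **The prime `𝔭_ι` of `K` induced by the embedding datum** `ι : ℚ̄_p ≃ ℂ` (and the complex embedding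
`σ`): the non-zero prime `{k ∈ 𝓞 K : ‖ι⁻¹(σ k)‖ < 1}` of `𝓞 K`, i.e. the prime above `p` cut out by
the `p`-adic embedding `i_p = ι⁻¹ ∘ σ` — Castella–Hsieh's "prime induced by `i_p`" and the `𝔭` of the
compatibility clause of Castella 2018 Thm. 3.1 (tree fact `castella2018_exists_isBDPLFunction`).
[cite: CastellaHsieh2018, §3.3 (arXiv:1505.08165 p. 9)] [cite: Castella2018, Thm. 3.1] -/
def primeOfEmbeddingDatum : HeightOneSpectrum (𝓞 K) :=
  ⟨primeOfEmbeddingDatumIdeal p ι σ, isPrime_primeOfEmbeddingDatumIdeal p ι σ,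
    primeOfEmbeddingDatumIdeal_ne_bot p ι σ⟩

/-- **The compatibility clause, by construction**: `k ∈ 𝔭_ι ↔ ‖ι⁻¹(σ k)‖ < 1`.
[cite: Castella2018, Thm. 3.1] -/
theorem mem_primeOfEmbeddingDatum_iff (k : 𝓞 K) :
    k ∈ (primeOfEmbeddingDatum p ι σ).asIdeal ↔ ‖ι.symm (σ (k : K))‖ < 1 := Iff.rfl

/-- `p ∈ 𝔭_ι`: the induced prime lies above `p`. [folklore] -/
theorem natCast_mem_primeOfEmbeddingDatum :
    ((p : ℕ) : 𝓞 K) ∈ (primeOfEmbeddingDatum p ι σ).asIdeal :=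
  natCast_mem_primeOfEmbeddingDatumIdeal p ι σ

/-- **The clause determines the prime**: any prime `𝔭` of `𝓞 K` with `k ∈ 𝔭 ↔ ‖ι⁻¹(σ k)‖ < 1` for all
`k` IS `𝔭_ι`. So a consumer of Castella 2018 Thm. 3.1 stated "for `𝔭` compatible with `ι`" loses
nothing by taking `𝔭 := primeOfEmbeddingDatum p ι σ`. [folklore] -/
theorem eq_primeOfEmbeddingDatum_of_forall_mem_iff {𝔭 : HeightOneSpectrum (𝓞 K)}
    (h : ∀ k : 𝓞 K, k ∈ 𝔭.asIdeal ↔ ‖ι.symm (σ (k : K))‖ < 1) :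
    𝔭 = primeOfEmbeddingDatum p ι σ := by
  apply HeightOneSpectrum.ext
  ext k
  exact h k

end Prime

/-! ### Imaginary quadratic fields: one infinite place, the clause for every `w`, degree one -/

section Quadratic

variable {K : Type} [Field K] [NumberField K] (p : ℕ) [Fact p.Prime] (ι : PadicAlgCl p ≃+* ℂ)

/-- An imaginary quadratic field has exactly one infinite place (`r₁ = 0` as `K` is totally complex,
`r₁ + 2 r₂ = [K : ℚ] = 2`, so `r₂ = 1`). [folklore] -/
theorem subsingleton_infinitePlace_of_isImaginaryQuadratic (hK : IsImaginaryQuadratic K) :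
    Subsingleton (InfinitePlace K) := by
  haveI : IsTotallyComplex K := hK.2
  have h0 : InfinitePlace.nrRealPlaces K = 0 :=
    (NumberField.nrRealPlaces_eq_zero_iff (K := K)).mpr inferInstance
  have hsum := InfinitePlace.card_add_two_mul_card_eq_rank K
  have hcard : Fintype.card (InfinitePlace K) = 1 := by
    rw [InfinitePlace.card_eq_nrRealPlaces_add_nrComplexPlaces, h0]
    rw [h0, hK.1] at hsum
    omega
  exact Fintype.card_le_one_iff_subsingleton.mp hcard.le

/-- **The compatibility clause of Castella 2018 Thm. 3.1 in its exact `∀ w` form** for an imaginary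
quadratic `K`: with `𝔭 := 𝔭_ι` built from the embedding of ANY infinite place `w₀` (there is only
one), `∀ (w : InfinitePlace K) (k : 𝓞 K), k ∈ 𝔭 ↔ ‖ι⁻¹(w.embedding k)‖ < 1`.
[cite: Castella2018, Thm. 3.1] -/
theorem forall_mem_primeOfEmbeddingDatum_iff (hK : IsImaginaryQuadratic K) (w₀ : InfinitePlace K) :
    ∀ (w : InfinitePlace K) (k : 𝓞 K),
      k ∈ (primeOfEmbeddingDatum p ι w₀.embedding).asIdeal ↔ ‖ι.symm (w.embedding (k : K))‖ < 1 := by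
  intro w k
  haveI := subsingleton_infinitePlace_of_isImaginaryQuadratic hK
  rw [Subsingleton.elim w w₀]
  exact mem_primeOfEmbeddingDatum_iff p ι w₀.embedding k

/-- **`𝔭_ι` has degree one when `p` splits** in the quadratic field `K`:
`e(𝔭_ι|p) = f(𝔭_ι|p) = 1` (tree `degreeOne_of_splitsIn`), so THE embedding
`embAt K p 𝔭_ι : K ↪ K_{𝔭_ι} = ℚ_p` of route R1 is available at `𝔭_ι`. [folklore] -/
theorem degreeOne_primeOfEmbeddingDatum (h2 : Module.finrank ℚ K = 2) (hs : SplitsIn K p)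
    (σ : K →+* ℂ) :
    (primeOfEmbeddingDatum p ι σ).asIdeal.ramificationIdx (𝓞 ℚ) = 1 ∧
      (primeOfEmbeddingDatum p ι σ).asIdeal.inertiaDeg (𝓞 ℚ) = 1 :=
  degreeOne_of_splitsIn h2 hs (natCast_mem_primeOfEmbeddingDatum p ι σ)

/-- An infinite place of `K` exists (a number field has `r₁ + r₂ ≥ 1`). [folklore] -/
theorem nonempty_infinitePlace : Nonempty (InfinitePlace K) := inferInstance

end Quadratic

/-! ### The conjugate datum, and: EVERY prime above a split `p` is induced by `ι` or by `ι ∘ conj`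
(gen 20 append; the glue asked for by team x11b3's r2, INBOX 2026-08-21T07:12:20Z) -/

section Conjugate

variable {K : Type} [Field K] [NumberField K] (p : ℕ) [Fact p.Prime] (ι : PadicAlgCl p ≃+* ℂ)
  (σ : K →+* ℂ)

omit [NumberField K] in
/-- The inverse of complex conjugation as a ring automorphism is complex conjugation. [folklore] -/
theorem starRingAut_symm_apply (z : ℂ) : (starRingAut : ℂ ≃+* ℂ).symm z = starRingEnd ℂ z := by
  rw [RingEquiv.symm_apply_eq, starRingAut_apply, starRingEnd_apply, star_star]

/-- **Twisting the embedding datum by complex conjugation conjugates the complex embedding**: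
`𝔭_{ι ∘ conj, σ} = 𝔭_{ι, σ̄}` — since `(ι.trans conj)⁻¹ = conj ∘ ι⁻¹… = ι⁻¹ ∘ conj` on `ℂ` and
`σ̄ = conj ∘ σ` (`ComplexEmbedding.conjugate`). [folklore] -/
theorem primeOfEmbeddingDatum_trans_starRingAut :
    primeOfEmbeddingDatum p (ι.trans (starRingAut : ℂ ≃+* ℂ)) σ =
      primeOfEmbeddingDatum p ι (ComplexEmbedding.conjugate σ) := by
  apply HeightOneSpectrum.ext
  ext k
  rw [mem_primeOfEmbeddingDatum_iff, mem_primeOfEmbeddingDatum_iff, RingEquiv.symm_trans_apply,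
    starRingAut_symm_apply, ComplexEmbedding.conjugate_coe_eq]

/-- **Every prime of `K` above a split `p` is induced by `ι` or by `ι ∘ conj`.** For an imaginary
quadratic `K`, an embedding datum `ι : ℚ̄_p ≃ ℂ`, any infinite place `w₀` and ANY prime `𝔭 ∋ p` of
`𝓞 K`: `𝔭 = 𝔭_{ι, w₀}` or `𝔭 = 𝔭_{ι ∘ conj, w₀}`. Proof: `𝔭` and `𝔭_ι` lie over the same prime of
`ℚ`, so `𝔭 = τ • 𝔭_ι` for some `τ ∈ Gal(K/ℚ)` (transitivity, Cassels–Fröhlich VII Prop. 1.2 (ii),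
tree `HeightOneSpectrum.exists_algEquiv_smul_eq`); the complex embedding `w₀.embedding ∘ τ⁻¹`
defines the unique infinite place, hence equals `w₀.embedding` or its conjugate
(`InfinitePlace.mk_eq_iff`); in the first case `𝔭 = 𝔭_ι`, in the second `𝔭 = 𝔭_{ι ∘ conj}`
(`primeOfEmbeddingDatum_trans_starRingAut`). Consequence for consumers of Castella 2018 Thm. 3.1:
a statement quantified over ALL primes `𝔭 ∣ p` with the compatibility clause for SOME datum is
covered by the two data `ι`, `ι.trans starRingAut` — no choice of `ι` per prime is needed (the
"anti-vacuity of `∃ ι', InducesPrime ι' 𝔭`" asked by team x11b3, route planner 2).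
[cite: CasselsFrohlichANT1967, Ch. VII Prop. 1.2 (ii)] -/
theorem eq_primeOfEmbeddingDatum_or_eq_trans_starRingAut (hK : IsImaginaryQuadratic K)
    (w₀ : InfinitePlace K) {𝔭 : HeightOneSpectrum (𝓞 K)} (h𝔭 : ((p : ℕ) : 𝓞 K) ∈ 𝔭.asIdeal) :
    𝔭 = primeOfEmbeddingDatum p ι w₀.embedding ∨
      𝔭 = primeOfEmbeddingDatum p (ι.trans (starRingAut : ℂ ≃+* ℂ)) w₀.embedding := by
  haveI : IsGalois ℚ K := by
    haveI : Algebra.IsQuadraticExtension ℚ K := ⟨hK.1⟩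
    infer_instance
  haveI := subsingleton_infinitePlace_of_isImaginaryQuadratic hK
  set 𝔭₀ := primeOfEmbeddingDatum p ι w₀.embedding with h𝔭₀def
  have hunder : 𝔭₀.under (𝓞 ℚ) = 𝔭.under (𝓞 ℚ) := by
    rw [under_eq_ratPlace_of_mem (natCast_mem_primeOfEmbeddingDatum p ι w₀.embedding),
      under_eq_ratPlace_of_mem h𝔭]
  obtain ⟨τ, hτ⟩ :=
    Literature.NumberTheory.Automorphic.HeightOneSpectrum.exists_algEquiv_smul_eq (F := ℚ) hunder
  -- membership in `𝔭 = τ • 𝔭₀` through `τ⁻¹`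
  have hmem : ∀ k : 𝓞 K, k ∈ 𝔭.asIdeal ↔ ‖ι.symm (w₀.embedding (τ.symm (k : K)))‖ < 1 := by
    intro k
    rw [← hτ, ← smul_inv_smul τ k,
      Literature.NumberTheory.Automorphic.HeightOneSpectrum.smul_mem_smul_asIdeal_iff,
      mem_primeOfEmbeddingDatum_iff, smul_inv_smul,
      Literature.NumberTheory.Automorphic.RingOfIntegers.coe_algEquiv_smul, AlgEquiv.aut_inv]
  -- the embedding `w₀.embedding ∘ τ⁻¹` defines the (unique) infinite place
  set φ : K →+* ℂ := w₀.embedding.comp (τ.symm : K ≃ₐ[ℚ] K).toRingEquiv.toRingHom with hφdef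
  have hφ : ∀ k : K, φ k = w₀.embedding (τ.symm k) := fun k ↦ rfl
  have hmk : InfinitePlace.mk φ = InfinitePlace.mk w₀.embedding := Subsingleton.elim _ _
  rcases InfinitePlace.mk_eq_iff.mp hmk with h | h
  · left
    apply HeightOneSpectrum.ext
    ext k
    rw [hmem k, ← hφ, h]
    exact (mem_primeOfEmbeddingDatum_iff p ι w₀.embedding k).symm
  · right
    apply HeightOneSpectrum.ext
    ext k
    have hk : w₀.embedding (τ.symm (k : K)) = starRingEnd ℂ (w₀.embedding (k : K)) := by
      have h1 : starRingEnd ℂ (φ (k : K)) = w₀.embedding (k : K) := by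
        rw [← ComplexEmbedding.conjugate_coe_eq, h]
      rw [← hφ, ← h1, starRingEnd_self_apply]
    rw [hmem k, hk, primeOfEmbeddingDatum_trans_starRingAut]
    change _ ↔ k ∈ (primeOfEmbeddingDatum p ι (ComplexEmbedding.conjugate w₀.embedding)).asIdeal
    rw [mem_primeOfEmbeddingDatum_iff, ComplexEmbedding.conjugate_coe_eq]

/-- The same for the ideal-membership form used by consumers: for every prime `𝔭 ∋ p` there is a
datum `ι' ∈ {ι, ι ∘ conj}` whose compatibility clause (Castella 2018 Thm. 3.1) holds at `𝔭` for
every infinite place. [cite: Castella2018, Thm. 3.1] -/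
theorem exists_datum_forall_mem_iff (hK : IsImaginaryQuadratic K) {𝔭 : HeightOneSpectrum (𝓞 K)}
    (h𝔭 : ((p : ℕ) : 𝓞 K) ∈ 𝔭.asIdeal) :
    ∃ ι' : PadicAlgCl p ≃+* ℂ, (ι' = ι ∨ ι' = ι.trans (starRingAut : ℂ ≃+* ℂ)) ∧
      ∀ (w : InfinitePlace K) (k : 𝓞 K), k ∈ 𝔭.asIdeal ↔ ‖ι'.symm (w.embedding (k : K))‖ < 1 := by
  obtain ⟨w₀⟩ := (inferInstance : Nonempty (InfinitePlace K))
  rcases eq_primeOfEmbeddingDatum_or_eq_trans_starRingAut p ι hK w₀ h𝔭 with h | h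
  · exact ⟨ι, Or.inl rfl, h ▸ forall_mem_primeOfEmbeddingDatum_iff p ι hK w₀⟩
  · exact ⟨ι.trans starRingAut, Or.inr rfl, h ▸ forall_mem_primeOfEmbeddingDatum_iff p _ hK w₀⟩

end Conjugate

end Summit.BirchSwinnertonDyer.Rank1Residual.X11b

end
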